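import Mathlib
import HarnessLib
import Summits.NavierStokesRegularity.NavierStokesRegularity.Theorems.PoloidalWindowDoorPoloidalWindowRigidityHorizontalFlatPast
import Summits.NavierStokesRegularity.NavierStokesRegularity.Theorems.PoloidalWindowDoorPoloidalWindowRigidityForwardSmallness
import Summits.NavierStokesRegularity.NavierStokesRegularity.Theorems.PoloidalWindowDoorPoloidalWindowRigidityVerticalShearGerm

/-!
# Route `PoloidalWindowDoor`, crux `PoloidalWindowRigidity` (K2, stmt-NavierStokesRegularity-19708), line «lrc-jet» v2 —
# stratum (TV) «time-dependent proportional shear»: THE SLOPE IS BOUNDED AND BOUNDED AWAY FROM ZERO IN THE FAR PAST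
# (`limsup_{τ→−∞}|μ(τ)| = ∞ ⇒ v ≡ 0` and `liminf_{τ→−∞}|μ(τ)| = 0 ⇒ v ≡ 0`, zoom-out at PRESCRIBED far-past times)

Cell ns-regularity-ideate, K2 lead ns-poloidal-K2-p1 (gen 4; `--supports stmt-…-19708`; sharpens the split of the
registered stub `stub_tvLiminf` of skeleton lrc-jet v2).

`…HorizontalFlatPast` (p519353) emptied the growth branch `μ(τ) → −∞` of (TV) by a zoom-out at bad points.  With the
forward ε-regularity of `…ForwardSmallness` a nontrivial profile has bad points on EVERY far-past slice
(`exists_uniformly_nonsmall`), so the zoom-out may be centred at ANY prescribed sequence of far-past times — here: where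
the slope is extreme — and ONE-SLICE doors at the hot spot `s = −1` of the limit suffice:

* `exists_zoomOut_fderiv` — the zoom-out limit at bad points WITH GRADIENTS and POLOIDALITY (reusable): recentred
  parabolic zooms at `(t_k, x_k)` with `ε ≤ √(−t_k)‖v(t_k,x_k)‖` converge along a subsequence, fields and gradients
  (KNSS compactness `exists_tendsto_of_isTypeIAncientMild_seq`), to a poloidal member `W` of `𝔓(C)` with `ε ≤ ‖W(−1,0)‖`;
  the gradients of `W(s)` are the limits of `(−t_k) Dv(−t_k s)(x_k + √(−t_k)·)`.
* `eq_zero_of_timeShear_limsup` — class + poloidal + all-slices proportional shear `∂₂v_b(s,·) = μ(s)∂_b v₂(s,·)` with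
  `limsup_{τ→−∞}|μ(τ)| = ∞` (`∀ M T, ∃ τ < T, M ≤ |μ τ|`) ⇒ `v ≡ 0`: zoom out at far-past times `t_k` with
  `|μ(t_k)| ≥ k+1`; the limit's slice `s = −1` is FLAT along `e₀` (`|∂₀v₂| = |∂₂v₀|/|μ| ≤ C₁/((−t)|μ|)`), and nsreg-p6's
  one-slice flat door `…OneSlice.eq_zero_of_flat_slice` shuts.  (Supersedes p519353's `eq_zero_of_timeShear_unbounded`,
  which needed `|μ(τ)| → ∞`.)
* `eq_zero_of_timeShear_liminf_zero` — the same with `liminf_{τ→−∞}|μ(τ)| = 0` (`∀ m > 0, ∀ T, ∃ τ < T, |μ τ| ≤ m`)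
  ⇒ `v ≡ 0`: at times with `|μ(t_k)| ≤ 1/(k+1)` the limit's slice `s = −1` is VERTICALLY RIGID (`∂₂W_h ≡ 0`,
  `|∂₂v_b| = |μ||∂_b v₂| ≤ |μ|C₁/(−t)`), and nsreg-p7's germ `…VerticalShearGerm.eq_zero_of_verticalShear_eq_zero_on_open`
  shuts.
* `nonflatLiouville_of_timeShear_limsup` / `nonflatLiouville_of_timeShear_liminf_zero` — not backward-singular.

So the registered stub `stub_tvLiminf` (ns-poloidal-K2-p2 g3, M12) may assume WLOG `m ≤ |μ(τ)| ≤ M` on a far-past tail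
(`0 < m`): the slope of a nontrivial (TV) profile is bounded and bounded away from `0` near `τ = −∞`; with K2-p3 g4's
stratum (L) «`μ(τ) → μ⋆`» only the bounded OSCILLATING slope needs the variance mechanism.

WHAT THIS IS NOT: not a claim about Navier–Stokes regularity, not LRC″ and not (TV) — two more asymptotic strata of the
poloidal class, mechanism-free (bears_on LADDER-NS N0, rung N0-LocalTubeDoorPoloidal).
-/

noncomputable section

-- the summit and its single sub-problem share the name (CONVENTIONS §1), as in every Theorems file
set_option linter.dupNamespace false

namespace Summit.NavierStokesRegularity.NavierStokesRegularity.Theorems.PoloidalWindowDoorPoloidalWindowRigidityTimeShearPast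

open MeasureTheory Set Function Filter Topology
open scoped RealInnerProductSpace InnerProductSpace
open Literature.Analysis Literature.Analysis.FluidPDE
open Summit.NavierStokesRegularity.NavierStokesRegularity.Theorems
open Summit.NavierStokesRegularity.NavierStokesRegularity.Theorems.PoloidalWindowDoorPoloidalWindowRigidityPoloidalExtremal
open Summit.NavierStokesRegularity.NavierStokesRegularity.Theorems.PoloidalWindowDoorPoloidalWindowRigidityZoomOut
open Summit.NavierStokesRegularity.NavierStokesRegularity.Theorems.PoloidalWindowDoorPoloidalWindowRigidityOneSlice
open Summit.NavierStokesRegularity.NavierStokesRegularity.Theorems.PoloidalWindowDoorPoloidalWindowRigidityClassRate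
open Summit.NavierStokesRegularity.NavierStokesRegularity.Theorems.PoloidalWindowDoorPoloidalWindowRigidityWindow
open Summit.NavierStokesRegularity.NavierStokesRegularity.Theorems.PoloidalWindowDoorPoloidalWindowRigidityFlat
open Summit.NavierStokesRegularity.NavierStokesRegularity.Theorems.PoloidalWindowDoorPoloidalWindowRigidityForwardSmallness
open Summit.NavierStokesRegularity.NavierStokesRegularity.Theorems.PoloidalWindowDoorPoloidalWindowRigidityVerticalShearGerm

variable {C : ℝ} {v : ℝ → EuclideanSpace ℝ (Fin 3) → EuclideanSpace ℝ (Fin 3)}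

/-! ### the zoom-out limit at bad points, with gradients and poloidality -/

/-- **The zoom-out limit at bad points WITH GRADIENTS (poloidal class).**  Let `v` be a profile of the route's Type-I
class, poloidal along `e₃` on every slice, and let `t_k < 0`, `x_k` be times and points with
`ε ≤ √(−t_k)‖v(t_k, x_k)‖`.  Then along a subsequence `φ` the recentred zooms `c_k v(c_k² s, x_k + c_k y)`, `c_k = √(−t_k)`,
converge — fields and gradients, pointwise on the open slab — to a poloidal member `W` of the KNSS class `𝔓(C)` with
`ε ≤ ‖W(−1, 0)‖`; in particular `DW(s)(y) = lim_j (−t_{φ j}) • Dv(−t_{φ j} s)(x_{φ j} + √(−t_{φ j}) y)`. -/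
theorem exists_zoomOut_fderiv (hrate : HasTypeITimeDecay C v)
    (hcont : ContinuousOn (uncurry v) (Iio (0 : ℝ) ×ˢ univ))
    (hmild : ∀ s t : ℝ, s < t → t < 0 → ∀ x,
      v t x = UnboundedOperators.heatExtension (v s) (t - s) x - oseenDuhamel 1 s v v t x)
    (hdiv : ∀ t < 0, VectorCalculus.IsDivFree (v t))
    (hpol : ∀ s < 0, ∀ y, ⟪curl (v s) y, EuclideanSpace.single 2 (1 : ℝ)⟫_ℝ = 0)
    {ε : ℝ} {tk : ℕ → ℝ} {xk : ℕ → EuclideanSpace ℝ (Fin 3)} (htk : ∀ k, tk k < 0)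
    (hbad : ∀ k, ε ≤ Real.sqrt (-tk k) * ‖v (tk k) (xk k)‖) :
    ∃ (φ : ℕ → ℕ) (W : ℝ → EuclideanSpace ℝ (Fin 3) → EuclideanSpace ℝ (Fin 3)), StrictMono φ ∧
      IsTypeIAncientMild C W ∧ (∀ s < 0, ∀ y, ⟪curl (W s) y, EuclideanSpace.single 2 (1 : ℝ)⟫_ℝ = 0) ∧
      ε ≤ ‖W (-1) 0‖ ∧
      ∀ s < 0, ∀ y, Tendsto (fun j => (-tk (φ j)) •
        fderiv ℝ (v (-tk (φ j) * s)) (xk (φ j) + Real.sqrt (-tk (φ j)) • y)) atTop (𝓝 (fderiv ℝ (W s) y)) := by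
  set c : ℕ → ℝ := fun k => Real.sqrt (-tk k) with hcdef
  have hc0 : ∀ k, 0 < c k := fun k => Real.sqrt_pos.2 (neg_pos.2 (htk k))
  have hc2 : ∀ k, c k ^ 2 = -tk k := fun k => Real.sq_sqrt (neg_pos.2 (htk k)).le
  -- the recentred zooms: poloidal members of `𝔓(C)`
  have hA : IsTypeIAncientMild C v := isTypeIAncientMild_of_class hrate hcont hmild hdiv
  set vk : ℕ → ℝ → EuclideanSpace ℝ (Fin 3) → EuclideanSpace ℝ (Fin 3) := fun k =>
    nsRescale (c k) (fun t x => v t (xk k + x)) with hvk_def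
  have hvk : ∀ k, IsTypeIAncientMild C (vk k) := fun k =>
    isTypeIAncientMild_nsRescale (isTypeIAncientMild_translate hA (xk k)) (hc0 k)
  have hvkpol : ∀ k, ∀ s < 0, ∀ y, ⟪curl (vk k s) y, EuclideanSpace.single 2 (1 : ℝ)⟫_ℝ = 0 := fun k =>
    poloidal_nsRescale (poloidal_translate hpol (xk k)) (hc0 k)
  have hval : ∀ k, ‖vk k (-1) 0‖ = Real.sqrt (-tk k) * ‖v (tk k) (xk k)‖ := fun k => by
    simp only [hvk_def]
    rw [nsRescale_apply, smul_zero, add_zero, mul_neg_one, hc2 k, neg_neg, norm_smul,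
      Real.norm_of_nonneg (Real.sqrt_nonneg _)]
  have hDk : ∀ k, ∀ s y, fderiv ℝ (vk k s) y = (-tk k) • fderiv ℝ (v (-tk k * s)) (xk k + c k • y) := by
    intro k s y
    simp only [hvk_def]
    rw [fderiv_nsRescale_slice, fderiv_translate, hc2 k]
  -- KNSS compactness, fields AND gradients
  obtain ⟨φ, hφ, W, hW, hpt, hDpt, -, -⟩ := exists_tendsto_of_isTypeIAncientMild_seq C hvk
  have hWpol : ∀ s < 0, ∀ y, ⟪curl (W s) y, EuclideanSpace.single 2 (1 : ℝ)⟫_ℝ = 0 := fun s hs y =>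
    poloidal_of_tendsto (hDpt s hs y) fun j => hvkpol (φ j) s hs y
  have hnorm : ε ≤ ‖W (-1) 0‖ := by
    refine ge_of_tendsto ((hpt (-1) (by norm_num) 0).norm) (Eventually.of_forall fun j => ?_)
    rw [hval]
    exact hbad (φ j)
  refine ⟨φ, W, hφ, hW, hWpol, hnorm, fun s hs y => ?_⟩
  have h := hDpt s hs y
  simp only [hDk] at h
  exact h

/-! ### `limsup |μ| = ∞`: a flat slice at the hot spot -/

/-- **(TV) with `limsup_{τ→−∞}|μ(τ)| = ∞` is empty.**  Let `v` be a profile of the route's Type-I class, poloidal along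
`e₃`, every slice of which is proportional-shear — `∂₂v_b(s,y) = μ(s) ∂_b v₂(s,y)` (`b = 0,1`) — with a slope function
unbounded near `−∞`: `∀ M T, ∃ τ < T, M ≤ |μ τ|`.  Then `v ≡ 0`. -/
theorem eq_zero_of_timeShear_limsup (hrate : HasTypeITimeDecay C v)
    (hcont : ContinuousOn (uncurry v) (Iio (0 : ℝ) ×ˢ univ))
    (hmild : ∀ s t : ℝ, s < t → t < 0 → ∀ x,
      v t x = UnboundedOperators.heatExtension (v s) (t - s) x - oseenDuhamel 1 s v v t x)
    (hdiv : ∀ t < 0, VectorCalculus.IsDivFree (v t))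
    (hpol : ∀ s < 0, ∀ y, ⟪curl (v s) y, EuclideanSpace.single 2 (1 : ℝ)⟫_ℝ = 0) {μ : ℝ → ℝ}
    (hslope : ∀ s < 0, ∀ y, ∀ b : Fin 3, b ≠ 2 →
      fderiv ℝ (v s) y (EuclideanSpace.single 2 1) b = μ s * fderiv ℝ (v s) y (EuclideanSpace.single b 1) 2)
    (hμ : ∀ M T : ℝ, ∃ τ < T, M ≤ |μ τ|) :
    ∀ t < 0, ∀ x, v t x = 0 := by
  by_contra hne
  push Not at hne
  obtain ⟨ε, hε, T₀, hT₀, hbadT⟩ := exists_uniformly_nonsmall hrate hmild hne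
  obtain ⟨C₁, hC₁⟩ := exists_fderiv_rate_of_class hrate hcont hmild
  -- ## far-past times with large slope, and bad points on those slices
  have hch : ∀ k : ℕ, ∃ t : ℝ, t < T₀ ∧ ((k : ℝ) + 1) ≤ |μ t| ∧ ∃ x, ε < Real.sqrt (-t) * ‖v t x‖ := by
    intro k
    obtain ⟨τ, hτ, hμτ⟩ := hμ ((k : ℝ) + 1) T₀
    obtain ⟨x, hx⟩ := hbadT τ hτ
    exact ⟨τ, hτ, hμτ, x, hx⟩
  choose tk htkT hμk xk hxk using hch
  have htk0 : ∀ k, tk k < 0 := fun k => (htkT k).trans hT₀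
  -- ## zoom out there
  obtain ⟨φ, W, hφ, hW, hWpol, hnorm, hD⟩ :=
    exists_zoomOut_fderiv hrate hcont hmild hdiv hpol htk0 fun k => (hxk k).le
  -- ## the hot-spot slice of the limit is flat along `e₀`
  have hs1 : (-1 : ℝ) < 0 := by norm_num
  have hflat : ∀ y, ⟪fderiv ℝ (W (-1)) y (EuclideanSpace.single 0 1), EuclideanSpace.single 2 (1 : ℝ)⟫_ℝ = 0 := by
    intro y
    -- the scalar sequence converging to `⟪DW(−1)(y)[e₀], e₃⟫ = ∂₀W₂(−1,y)`
    set g : ℕ → ℝ := fun j => ⟪((-tk (φ j)) • fderiv ℝ (v (-tk (φ j) * (-1)))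
      (xk (φ j) + Real.sqrt (-tk (φ j)) • y)) (EuclideanSpace.single 0 1), EuclideanSpace.single 2 (1 : ℝ)⟫_ℝ with hg
    have hlim : Tendsto g atTop (𝓝 ⟪fderiv ℝ (W (-1)) y (EuclideanSpace.single 0 1), EuclideanSpace.single 2 (1 : ℝ)⟫_ℝ) :=
      (((ContinuousLinearMap.apply ℝ (EuclideanSpace ℝ (Fin 3)) (EuclideanSpace.single 0 1)).continuous.tendsto _).comp
        (hD (-1) hs1 y)).inner tendsto_const_nhds
    -- its size is at most `|C₁|/(φ j + 1)`
    have hbd : ∀ j, |g j| ≤ |C₁| * (1 / (((φ j : ℕ) : ℝ) + 1)) := by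
      intro j
      set t : ℝ := tk (φ j) with htdef
      have ht0 : t < 0 := htk0 _
      have hnt : 0 < -t := neg_pos.2 ht0
      set x : EuclideanSpace ℝ (Fin 3) := xk (φ j) + Real.sqrt (-tk (φ j)) • y with hxdef
      have hμpos : 0 < |μ t| := lt_of_lt_of_le (by positivity) (hμk (φ j))
      have e1 : -tk (φ j) * (-1) = t := by rw [htdef]; ring
      have hgj : g j = (-t) * fderiv ℝ (v t) x (EuclideanSpace.single 0 1) 2 := by
        simp only [hg, e1]
        rw [_root_.smul_apply, inner_smul_left, conj_trivial, EuclideanSpace.inner_single_right, one_mul, conj_trivial]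
      -- `∂₀v₂ = ∂₂v₀/μ`, `|∂₂v₀| ≤ ‖Dv‖ ≤ C₁/(−t)`
      have hrel : fderiv ℝ (v t) x (EuclideanSpace.single 2 1) 0 =
          μ t * fderiv ℝ (v t) x (EuclideanSpace.single 0 1) 2 := hslope t ht0 x 0 (by decide)
      have h3 : |fderiv ℝ (v t) x (EuclideanSpace.single 2 1) 0| ≤ |C₁| / (-t) := by
        have h1 : |fderiv ℝ (v t) x (EuclideanSpace.single 2 1) 0| ≤
            ‖fderiv ℝ (v t) x (EuclideanSpace.single 2 1)‖ := by
          rw [← Real.norm_eq_abs]; exact PiLp.norm_apply_le _ 0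
        have hn1 : ‖(EuclideanSpace.single 2 (1 : ℝ) : EuclideanSpace ℝ (Fin 3))‖ = 1 := by simp
        have h2 : ‖fderiv ℝ (v t) x (EuclideanSpace.single 2 1)‖ ≤ ‖fderiv ℝ (v t) x‖ := by
          refine (ContinuousLinearMap.le_opNorm _ _).trans ?_
          rw [hn1, mul_one]
        exact h1.trans (h2.trans ((hC₁ t ht0 x).trans (div_le_div_of_nonneg_right (le_abs_self _) hnt.le)))
      have hkey : |fderiv ℝ (v t) x (EuclideanSpace.single 0 1) 2| =
          |fderiv ℝ (v t) x (EuclideanSpace.single 2 1) 0| / |μ t| := by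
        rw [hrel, abs_mul, mul_div_cancel_left₀ _ hμpos.ne']
      rw [hgj, abs_mul, abs_of_pos hnt, hkey, ← mul_div_assoc]
      rw [div_le_iff₀ hμpos]
      calc (-t) * |fderiv ℝ (v t) x (EuclideanSpace.single 2 1) 0| ≤ (-t) * (|C₁| / (-t)) :=
            mul_le_mul_of_nonneg_left h3 hnt.le
        _ = |C₁| := mul_div_cancel₀ _ hnt.ne'
        _ = |C₁| * (1 / ((((φ j : ℕ) : ℝ)) + 1)) * ((((φ j : ℕ) : ℝ)) + 1) := by
            field_simp
        _ ≤ |C₁| * (1 / ((((φ j : ℕ) : ℝ)) + 1)) * |μ t| :=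
            mul_le_mul_of_nonneg_left (hμk (φ j)) (by positivity)
    have hzero : Tendsto g atTop (𝓝 0) := by
      have hb : Tendsto (fun j => |C₁| * (1 / ((((φ j : ℕ) : ℝ)) + 1))) atTop (𝓝 0) := by
        have h := (tendsto_one_div_add_atTop_nhds_zero_nat (𝕜 := ℝ)).comp hφ.tendsto_atTop
        simpa using h.const_mul |C₁|
      exact squeeze_zero_norm (fun j => by rw [Real.norm_eq_abs]; exact hbd j) hb
    exact tendsto_nhds_unique hlim hzero
  -- ## the one-slice flat door shuts: `W ≡ 0`, contradiction
  have he0 : (EuclideanSpace.single 0 1 : EuclideanSpace ℝ (Fin 3)) ≠ 0 := fun h0 => by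
    simpa using congrArg (fun w : EuclideanSpace ℝ (Fin 3) => w 0) h0
  have he03 : ⟪(EuclideanSpace.single 0 1 : EuclideanSpace ℝ (Fin 3)), EuclideanSpace.single 2 (1 : ℝ)⟫_ℝ = 0 := by
    simp [EuclideanSpace.inner_single_left]
  have hW0 := eq_zero_of_flat_slice hW.hasTypeITimeDecay hW.continuousOn_uncurry
    (fun s t hst ht x => hW.mild_eq_heatExtension hst ht x) (fun t ht => hW.isDivFree ht)
    hs1 (hWpol (-1) hs1) he0 he03 hflat
  have h0 : W (-1) 0 = 0 := hW0 (-1) hs1 0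
  rw [h0, norm_zero] at hnorm
  linarith

/-- (TV) with `limsup_{τ→−∞}|μ(τ)| = ∞`: not backward-singular. -/
theorem nonflatLiouville_of_timeShear_limsup (hrate : HasTypeITimeDecay C v)
    (hcont : ContinuousOn (uncurry v) (Iio (0 : ℝ) ×ˢ univ))
    (hmild : ∀ s t : ℝ, s < t → t < 0 → ∀ x,
      v t x = UnboundedOperators.heatExtension (v s) (t - s) x - oseenDuhamel 1 s v v t x)
    (hdiv : ∀ t < 0, VectorCalculus.IsDivFree (v t))
    (hpol : ∀ s < 0, ∀ y, ⟪curl (v s) y, EuclideanSpace.single 2 (1 : ℝ)⟫_ℝ = 0) {μ : ℝ → ℝ}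
    (hslope : ∀ s < 0, ∀ y, ∀ b : Fin 3, b ≠ 2 →
      fderiv ℝ (v s) y (EuclideanSpace.single 2 1) b = μ s * fderiv ℝ (v s) y (EuclideanSpace.single b 1) 2)
    (hμ : ∀ M T : ℝ, ∃ τ < T, M ≤ |μ τ|) :
    ¬ IsBackwardSingularPoint v 0 :=
  not_backwardSingular_of_zero (eq_zero_of_timeShear_limsup hrate hcont hmild hdiv hpol hslope hμ)

/-! ### `liminf |μ| = 0`: a vertically rigid slice at the hot spot -/

/-- **(TV) with `liminf_{τ→−∞}|μ(τ)| = 0` is empty.**  Let `v` be a profile of the route's Type-I class, poloidal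
along `e₃`, every slice of which is proportional-shear with a slope function `μ` that comes arbitrarily close to `0` near
`−∞`: `∀ m > 0, ∀ T, ∃ τ < T, |μ τ| ≤ m`.  Then `v ≡ 0`. -/
theorem eq_zero_of_timeShear_liminf_zero (hrate : HasTypeITimeDecay C v)
    (hcont : ContinuousOn (uncurry v) (Iio (0 : ℝ) ×ˢ univ))
    (hmild : ∀ s t : ℝ, s < t → t < 0 → ∀ x,
      v t x = UnboundedOperators.heatExtension (v s) (t - s) x - oseenDuhamel 1 s v v t x)
    (hdiv : ∀ t < 0, VectorCalculus.IsDivFree (v t))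
    (hpol : ∀ s < 0, ∀ y, ⟪curl (v s) y, EuclideanSpace.single 2 (1 : ℝ)⟫_ℝ = 0) {μ : ℝ → ℝ}
    (hslope : ∀ s < 0, ∀ y, ∀ b : Fin 3, b ≠ 2 →
      fderiv ℝ (v s) y (EuclideanSpace.single 2 1) b = μ s * fderiv ℝ (v s) y (EuclideanSpace.single b 1) 2)
    (hμ : ∀ m : ℝ, 0 < m → ∀ T : ℝ, ∃ τ < T, |μ τ| ≤ m) :
    ∀ t < 0, ∀ x, v t x = 0 := by
  by_contra hne
  push Not at hne
  obtain ⟨ε, hε, T₀, hT₀, hbadT⟩ := exists_uniformly_nonsmall hrate hmild hne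
  obtain ⟨C₁, hC₁⟩ := exists_fderiv_rate_of_class hrate hcont hmild
  -- ## far-past times with small slope, and bad points on those slices
  have hch : ∀ k : ℕ, ∃ t : ℝ, t < T₀ ∧ |μ t| ≤ 1 / ((k : ℝ) + 1) ∧ ∃ x, ε < Real.sqrt (-t) * ‖v t x‖ := by
    intro k
    obtain ⟨τ, hτ, hμτ⟩ := hμ (1 / ((k : ℝ) + 1)) (by positivity) T₀
    obtain ⟨x, hx⟩ := hbadT τ hτ
    exact ⟨τ, hτ, hμτ, x, hx⟩
  choose tk htkT hμk xk hxk using hch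
  have htk0 : ∀ k, tk k < 0 := fun k => (htkT k).trans hT₀
  -- ## zoom out there
  obtain ⟨φ, W, hφ, hW, -, hnorm, hD⟩ :=
    exists_zoomOut_fderiv hrate hcont hmild hdiv hpol htk0 fun k => (hxk k).le
  -- ## the hot-spot slice of the limit is vertically rigid: `∂₂W_b(−1,·) ≡ 0`, `b = 0,1`
  have hs1 : (-1 : ℝ) < 0 := by norm_num
  have hrig : ∀ y, ∀ b : Fin 3, b ≠ 2 → fderiv ℝ (W (-1)) y (EuclideanSpace.single 2 1) b = 0 := by
    intro y b hb
    set g : ℕ → ℝ := fun j => (((-tk (φ j)) • fderiv ℝ (v (-tk (φ j) * (-1)))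
      (xk (φ j) + Real.sqrt (-tk (φ j)) • y)) (EuclideanSpace.single 2 1)) b with hg
    have hlim : Tendsto g atTop (𝓝 (fderiv ℝ (W (-1)) y (EuclideanSpace.single 2 1) b)) := by
      have h1 := ((ContinuousLinearMap.apply ℝ (EuclideanSpace ℝ (Fin 3)) (EuclideanSpace.single 2 1)).continuous.tendsto
        _).comp (hD (-1) hs1 y)
      have h2 := ((EuclideanSpace.proj (𝕜 := ℝ) b).continuous.tendsto _).comp h1
      simpa [Function.comp_def, hg] using h2
    have hbd : ∀ j, |g j| ≤ |C₁| * (1 / (((φ j : ℕ) : ℝ) + 1)) := by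
      intro j
      set t : ℝ := tk (φ j) with htdef
      have ht0 : t < 0 := htk0 _
      have hnt : 0 < -t := neg_pos.2 ht0
      set x : EuclideanSpace ℝ (Fin 3) := xk (φ j) + Real.sqrt (-tk (φ j)) • y with hxdef
      have e1 : -tk (φ j) * (-1) = t := by rw [htdef]; ring
      have hgj : g j = (-t) * fderiv ℝ (v t) x (EuclideanSpace.single 2 1) b := by
        simp only [hg, e1]
        rw [_root_.smul_apply, PiLp.smul_apply, smul_eq_mul]
      -- `∂₂v_b = μ ∂_b v₂`, `|∂_b v₂| ≤ ‖Dv‖ ≤ C₁/(−t)`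
      have hrel : fderiv ℝ (v t) x (EuclideanSpace.single 2 1) b =
          μ t * fderiv ℝ (v t) x (EuclideanSpace.single b 1) 2 := hslope t ht0 x b hb
      have h3 : |fderiv ℝ (v t) x (EuclideanSpace.single b 1) 2| ≤ |C₁| / (-t) := by
        have h1 : |fderiv ℝ (v t) x (EuclideanSpace.single b 1) 2| ≤
            ‖fderiv ℝ (v t) x (EuclideanSpace.single b 1)‖ := by
          rw [← Real.norm_eq_abs]; exact PiLp.norm_apply_le _ 2
        have hn1 : ‖(EuclideanSpace.single b (1 : ℝ) : EuclideanSpace ℝ (Fin 3))‖ = 1 := by simp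
        have h2 : ‖fderiv ℝ (v t) x (EuclideanSpace.single b 1)‖ ≤ ‖fderiv ℝ (v t) x‖ := by
          refine (ContinuousLinearMap.le_opNorm _ _).trans ?_
          rw [hn1, mul_one]
        exact h1.trans (h2.trans ((hC₁ t ht0 x).trans (div_le_div_of_nonneg_right (le_abs_self _) hnt.le)))
      rw [hgj, hrel, abs_mul, abs_mul, abs_of_pos hnt]
      calc (-t) * (|μ t| * |fderiv ℝ (v t) x (EuclideanSpace.single b 1) 2|)
          ≤ (-t) * ((1 / (((φ j : ℕ) : ℝ) + 1)) * (|C₁| / (-t))) :=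
            mul_le_mul_of_nonneg_left (mul_le_mul (hμk (φ j)) h3 (abs_nonneg _) (by positivity)) hnt.le
        _ = (1 / (((φ j : ℕ) : ℝ) + 1)) * ((-t) * (|C₁| / (-t))) := by ring
        _ = |C₁| * (1 / (((φ j : ℕ) : ℝ) + 1)) := by rw [mul_div_cancel₀ _ hnt.ne', mul_comm]
    have hzero : Tendsto g atTop (𝓝 0) := by
      have hb : Tendsto (fun j => |C₁| * (1 / ((((φ j : ℕ) : ℝ)) + 1))) atTop (𝓝 0) := by
        have h := (tendsto_one_div_add_atTop_nhds_zero_nat (𝕜 := ℝ)).comp hφ.tendsto_atTop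
        simpa using h.const_mul |C₁|
      exact squeeze_zero_norm (fun j => by rw [Real.norm_eq_abs]; exact hbd j) hb
    exact tendsto_nhds_unique hlim hzero
  -- ## nsreg-p7's vertically rigid germ shuts: `W ≡ 0`, contradiction
  have hW0 := eq_zero_of_verticalShear_eq_zero_on_open hW.hasTypeITimeDecay hW.continuousOn_uncurry
    (fun s t hst ht x => hW.mild_eq_heatExtension hst ht x) (fun t ht => hW.isDivFree ht)
    hs1 isOpen_univ univ_nonempty fun y _ => ⟨hrig y 0 (by decide), hrig y 1 (by decide)⟩
  have h0 : W (-1) 0 = 0 := hW0 (-1) hs1 0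
  rw [h0, norm_zero] at hnorm
  linarith

/-- (TV) with `liminf_{τ→−∞}|μ(τ)| = 0`: not backward-singular. -/
theorem nonflatLiouville_of_timeShear_liminf_zero (hrate : HasTypeITimeDecay C v)
    (hcont : ContinuousOn (uncurry v) (Iio (0 : ℝ) ×ˢ univ))
    (hmild : ∀ s t : ℝ, s < t → t < 0 → ∀ x,
      v t x = UnboundedOperators.heatExtension (v s) (t - s) x - oseenDuhamel 1 s v v t x)
    (hdiv : ∀ t < 0, VectorCalculus.IsDivFree (v t))
    (hpol : ∀ s < 0, ∀ y, ⟪curl (v s) y, EuclideanSpace.single 2 (1 : ℝ)⟫_ℝ = 0) {μ : ℝ → ℝ}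
    (hslope : ∀ s < 0, ∀ y, ∀ b : Fin 3, b ≠ 2 →
      fderiv ℝ (v s) y (EuclideanSpace.single 2 1) b = μ s * fderiv ℝ (v s) y (EuclideanSpace.single b 1) 2)
    (hμ : ∀ m : ℝ, 0 < m → ∀ T : ℝ, ∃ τ < T, |μ τ| ≤ m) :
    ¬ IsBackwardSingularPoint v 0 :=
  not_backwardSingular_of_zero (eq_zero_of_timeShear_liminf_zero hrate hcont hmild hdiv hpol hslope hμ)

end Summit.NavierStokesRegularity.NavierStokesRegularity.Theorems.PoloidalWindowDoorPoloidalWindowRigidityTimeShearPast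

end
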